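import Summits.AtomisticToContinuum.BoseEinsteinCondensation.Theorems.BECThomsonPrincipleGDTransferBareAdmissibleKinetic

/-!
# Route `BECThomsonPrinciple`, crux `GDTransfer` (stmt-AtomisticToContinuum-9482), line `dyson-dressed-witness`:
# stub `bareAdmissible`, part 3 — energy budgets through `P_i`, `1 - P_i`, `e_p(x_a)`, `Q_S`, `n̂₀^{-1/2}`

Support file of `stub_bareAdmissible`, continuing parts 1–2.  Bookkeeping of the a-priori bounds in the form of
a BUDGET `Φ_{A,B}(g) = A·𝓔(g) + B·‖g‖²` (`A ≤ B` in `ℝ≥0∞`; `A = 0` is the pure mass bound, `A = 1`,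
`B = 1 + ‖p‖²` the energy bound with the mode factor): each elementary operator multiplies the budget by a
constant depending only on `N`, `L`, `κ ≥ N²L⁻³‖v‖₁` —
`P_i`: `1 + κ` (`budget_cellAvg_le`); one `foldr` factor `P_a` / `1 - P_a`: `4 + 2κ` (`budget_step_le`), hence
`Q_S`: `(4 + 2κ)^N` (`budget_modeProj_le`); the plane-wave factor `e_p(x_a)`: `2 + 6N(2π/L)²` provided
`A‖p‖² ≤ B` (`budget_phase_le`); a finite sum of `T` terms: `2^{#T}` (`budget_finset_sum_le`, from the
parallelogram laws); a scalar `|c| ≤ 1`: `1`; whence `n̂₀^{-1/2} = Σ_{S≠∅}|S|^{-1/2}Q_S`: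
`2^{2^N}·2^N·(4 + 2κ)^N` (`budget_rootInv_le`).  Crude constants throughout (only their independence of the
state and of the mode matters).  All [folklore] (LSSY2005 App. A; arXiv:1211.2778 §2).
-/

noncomputable section

open MeasureTheory Filter
open scoped ENNReal NNReal ComplexConjugate

namespace Summit.AtomisticToContinuum.BoseEinsteinCondensation.Cruxes.GDTransfer.DysonDressedWitness

namespace Bare

open Literature.MathematicalPhysics.QuantumManyBody.BoseGas
open Summit.AtomisticToContinuum.BoseEinsteinCondensation.Theorems.GaussianDominationCan.Negative
open ChordVariation (continuous_foldr_cellAvg continuous_modeProj)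

variable {n : ℕ} {L : ℝ} {v : ℝ → ℝ≥0∞} {κ A B : ℝ≥0∞}

/-! ## Sums, differences, scalars -/

/-- `‖a + b‖² ≤ 2‖a‖² + 2‖b‖²` (parallelogram law). [folklore] -/
theorem mass_add_le {a b : Config (n + 1) → ℂ} (ha : Continuous a) (hb : Continuous b) :
    mass L (fun X => a X + b X) ≤ 2 * mass L a + 2 * mass L b :=
  le_self_add.trans (ChordVariation.mass_add_add_sub ha hb).le

/-- `‖a - b‖² ≤ 2‖a‖² + 2‖b‖²` (parallelogram law). [folklore] -/
theorem mass_sub_le {a b : Config (n + 1) → ℂ} (ha : Continuous a) (hb : Continuous b) :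
    mass L (fun X => a X - b X) ≤ 2 * mass L a + 2 * mass L b :=
  le_add_self.trans (ChordVariation.mass_add_add_sub ha hb).le

/-- `𝓔(a + b) ≤ 2𝓔(a) + 2𝓔(b)` (parallelogram law). [folklore] -/
theorem eform_add_le (hv : Measurable v) {a b : Config (n + 1) → ℂ} (ha : ContDiff ℝ 1 a)
    (hb : ContDiff ℝ 1 b) : eform v L (fun X => a X + b X) ≤ 2 * eform v L a + 2 * eform v L b :=
  le_self_add.trans (ChordVariation.eform_add_add_sub hv ha hb).le

/-- `𝓔(a - b) ≤ 2𝓔(a) + 2𝓔(b)` (parallelogram law). [folklore] -/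
theorem eform_sub_le (hv : Measurable v) {a b : Config (n + 1) → ℂ} (ha : ContDiff ℝ 1 a)
    (hb : ContDiff ℝ 1 b) : eform v L (fun X => a X - b X) ≤ 2 * eform v L a + 2 * eform v L b :=
  le_add_self.trans (ChordVariation.eform_add_add_sub hv ha hb).le

/-- **Budget of a sum**: `Φ(a + b) ≤ 2Φ(a) + 2Φ(b)`. [folklore] -/
theorem budget_add_le (hv : Measurable v) {a b : Config (n + 1) → ℂ} (ha : ContDiff ℝ 1 a)
    (hb : ContDiff ℝ 1 b) :
    A * eform v L (fun X => a X + b X) + B * mass L (fun X => a X + b X) ≤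
      2 * (A * eform v L a + B * mass L a) + 2 * (A * eform v L b + B * mass L b) := by
  calc A * eform v L (fun X => a X + b X) + B * mass L (fun X => a X + b X)
      ≤ A * (2 * eform v L a + 2 * eform v L b) + B * (2 * mass L a + 2 * mass L b) :=
        add_le_add (mul_le_mul' le_rfl (eform_add_le hv ha hb))
          (mul_le_mul' le_rfl (mass_add_le ha.continuous hb.continuous))
    _ = _ := by ring

/-- **Budget of a difference**: `Φ(a - b) ≤ 2Φ(a) + 2Φ(b)`. [folklore] -/
theorem budget_sub_le (hv : Measurable v) {a b : Config (n + 1) → ℂ} (ha : ContDiff ℝ 1 a)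
    (hb : ContDiff ℝ 1 b) :
    A * eform v L (fun X => a X - b X) + B * mass L (fun X => a X - b X) ≤
      2 * (A * eform v L a + B * mass L a) + 2 * (A * eform v L b + B * mass L b) := by
  calc A * eform v L (fun X => a X - b X) + B * mass L (fun X => a X - b X)
      ≤ A * (2 * eform v L a + 2 * eform v L b) + B * (2 * mass L a + 2 * mass L b) :=
        add_le_add (mul_le_mul' le_rfl (eform_sub_le hv ha hb))
          (mul_le_mul' le_rfl (mass_sub_le ha.continuous hb.continuous))
    _ = _ := by ring

/-- **Budget of a scalar multiple** with `|c| ≤ 1`: `Φ(c f) ≤ Φ(f)`. [folklore] -/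
theorem budget_smul_le (v : ℝ → ℝ≥0∞) {c : ℂ} (hc : ((‖c‖₊ : ℝ≥0∞)) ^ 2 ≤ 1)
    {f : Config (n + 1) → ℂ} (hf : ContDiff ℝ 1 f) :
    A * eform v L (fun X => c * f X) + B * mass L (fun X => c * f X) ≤
      A * eform v L f + B * mass L f := by
  rw [ChordVariation.eform_smul v c hf, ChordVariation.mass_smul c f]
  calc A * (((‖c‖₊ : ℝ≥0∞)) ^ 2 * eform v L f) + B * (((‖c‖₊ : ℝ≥0∞)) ^ 2 * mass L f)
      ≤ A * (1 * eform v L f) + B * (1 * mass L f) := by gcongr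
    _ = _ := by rw [one_mul, one_mul]

/-- **Budget of a finite sum**: `Φ(Σ_{t∈T} f_t) ≤ 2^{#T} Σ_{t∈T} Φ(f_t)`. [folklore] -/
theorem budget_finset_sum_le (hv : Measurable v) {ι : Type*} (T : Finset ι)
    {f : ι → Config (n + 1) → ℂ} (hf : ∀ t ∈ T, ContDiff ℝ 1 (f t)) :
    A * eform v L (fun X => ∑ t ∈ T, f t X) + B * mass L (fun X => ∑ t ∈ T, f t X) ≤
      2 ^ T.card * ∑ t ∈ T, (A * eform v L (f t) + B * mass L (f t)) := by
  classical
  induction T using Finset.induction_on with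
  | empty =>
    have h0 : eform v L (fun _ : Config (n + 1) => (0 : ℂ)) = 0 := by
      simp [eform, kineticDensity]
    have h1 : mass L (fun _ : Config (n + 1) => (0 : ℂ)) = 0 := by simp [mass]
    simp [h0, h1]
  | insert a T haT ih =>
    have hfa : ContDiff ℝ 1 (f a) := hf a (Finset.mem_insert_self a T)
    have hfT : ∀ t ∈ T, ContDiff ℝ 1 (f t) := fun t ht => hf t (Finset.mem_insert_of_mem ht)
    have hsum : ContDiff ℝ 1 (fun X => ∑ t ∈ T, f t X) := ContDiff.sum fun t ht => hfT t ht
    simp only [Finset.sum_insert haT, Finset.card_insert_of_notMem haT]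
    calc A * eform v L (fun X => f a X + ∑ t ∈ T, f t X) +
          B * mass L (fun X => f a X + ∑ t ∈ T, f t X)
        ≤ 2 * (A * eform v L (f a) + B * mass L (f a)) +
            2 * (A * eform v L (fun X => ∑ t ∈ T, f t X) + B * mass L (fun X => ∑ t ∈ T, f t X)) :=
          budget_add_le hv hfa hsum
      _ ≤ 2 * (A * eform v L (f a) + B * mass L (f a)) +
            2 * (2 ^ T.card * ∑ t ∈ T, (A * eform v L (f t) + B * mass L (f t))) := by
          gcongr
          exact ih hfT
      _ ≤ 2 ^ T.card * 2 * (A * eform v L (f a) + B * mass L (f a)) +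
            2 * (2 ^ T.card * ∑ t ∈ T, (A * eform v L (f t) + B * mass L (f t))) := by
          refine add_le_add ?_ le_rfl
          refine mul_le_mul' ?_ le_rfl
          calc (2 : ℝ≥0∞) = 1 * 2 := (one_mul _).symm
            _ ≤ 2 ^ T.card * 2 := mul_le_mul' (one_le_pow₀ one_le_two) le_rfl
      _ = 2 ^ (T.card + 1) * (A * eform v L (f a) + B * mass L (f a) +
            ∑ t ∈ T, (A * eform v L (f t) + B * mass L (f t))) := by ring

/-! ## The cell average and the `foldr` factors -/

/-- **Budget of `P_i`**: `Φ(P_i g) ≤ (1 + κ)Φ(g)` (`A ≤ B`, `κ ≥ N²L⁻³‖v‖₁`). [folklore] -/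
theorem budget_cellAvg_le (hL : 0 < L) (hv : Measurable v)
    (hκ : ((n + 1 : ℕ) : ℝ≥0∞) ^ 2 * ((ENNReal.ofReal (L ^ 3))⁻¹ * ∫⁻ x : Space, v ‖x‖) ≤ κ)
    (hAB : A ≤ B) (i : Fin (n + 1)) {g : Config (n + 1) → ℂ} (hg : ContDiff ℝ 1 g) :
    A * eform v L (cellAvg (n + 1) L i g) + B * mass L (cellAvg (n + 1) L i g) ≤
      (1 + κ) * (A * eform v L g + B * mass L g) := by
  calc A * eform v L (cellAvg (n + 1) L i g) + B * mass L (cellAvg (n + 1) L i g)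
      ≤ A * (eform v L g + κ * mass L g) + B * mass L g :=
        add_le_add (mul_le_mul' le_rfl (eform_cellAvg_le hL hv hκ i hg))
          (mul_le_mul' le_rfl (mass_cellAvg_le hL i hg.continuous))
    _ = A * eform v L g + B * mass L g + κ * (A * mass L g) := by ring
    _ ≤ A * eform v L g + B * mass L g + κ * (B * mass L g) := by gcongr
    _ ≤ A * eform v L g + B * mass L g + κ * (A * eform v L g + B * mass L g) := by
        gcongr
        exact le_add_self
    _ = (1 + κ) * (A * eform v L g + B * mass L g) := by ring

/-- **Budget of one `foldr` factor** `P_a` / `1 - P_a`: `≤ (4 + 2κ)Φ`. [folklore] -/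
theorem budget_step_le (hL : 0 < L) (hv : Measurable v)
    (hκ : ((n + 1 : ℕ) : ℝ≥0∞) ^ 2 * ((ENNReal.ofReal (L ^ 3))⁻¹ * ∫⁻ x : Space, v ‖x‖) ≤ κ)
    (hAB : A ≤ B) (S : Finset (Fin (n + 1))) (a : Fin (n + 1)) {f : Config (n + 1) → ℂ}
    (hf : ContDiff ℝ 1 f) :
    A * eform v L (if a ∈ S then cellAvg (n + 1) L a f else f - cellAvg (n + 1) L a f) +
        B * mass L (if a ∈ S then cellAvg (n + 1) L a f else f - cellAvg (n + 1) L a f) ≤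
      (4 + 2 * κ) * (A * eform v L f + B * mass L f) := by
  have hP := budget_cellAvg_le hL hv hκ hAB a hf
  split_ifs
  · refine hP.trans (mul_le_mul' (add_le_add ?_ (le_add_self.trans_eq (two_mul κ).symm)) le_rfl)
    norm_num
  · calc A * eform v L (f - cellAvg (n + 1) L a f) + B * mass L (f - cellAvg (n + 1) L a f)
        = A * eform v L (fun X => f X - cellAvg (n + 1) L a f X) +
            B * mass L (fun X => f X - cellAvg (n + 1) L a f X) := rfl
      _ ≤ 2 * (A * eform v L f + B * mass L f) +
            2 * (A * eform v L (cellAvg (n + 1) L a f) + B * mass L (cellAvg (n + 1) L a f)) :=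
          budget_sub_le hv hf (Lnss.contDiff_cellAvg a hf)
      _ ≤ 2 * (A * eform v L f + B * mass L f) +
            2 * ((1 + κ) * (A * eform v L f + B * mass L f)) := by gcongr
      _ = (4 + 2 * κ) * (A * eform v L f + B * mass L f) := by ring

/-- **Budget of the `foldr`** over a list `l`: `≤ (4 + 2κ)^{|l|} Φ(g)`. [folklore] -/
theorem budget_foldr_le (hL : 0 < L) (hv : Measurable v)
    (hκ : ((n + 1 : ℕ) : ℝ≥0∞) ^ 2 * ((ENNReal.ofReal (L ^ 3))⁻¹ * ∫⁻ x : Space, v ‖x‖) ≤ κ)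
    (hAB : A ≤ B) (S : Finset (Fin (n + 1))) (l : List (Fin (n + 1))) {g : Config (n + 1) → ℂ}
    (hg : ContDiff ℝ 1 g) :
    A * eform v L (l.foldr (fun i h => if i ∈ S then cellAvg (n + 1) L i h
        else h - cellAvg (n + 1) L i h) g) +
      B * mass L (l.foldr (fun i h => if i ∈ S then cellAvg (n + 1) L i h
        else h - cellAvg (n + 1) L i h) g) ≤
      (4 + 2 * κ) ^ l.length * (A * eform v L g + B * mass L g) := by
  induction l with
  | nil => simp
  | cons a l ih =>
    have hF := Lnss.contDiff_foldr_cellAvg (L := L) S l hg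
    rw [List.foldr_cons, List.length_cons, pow_succ]
    calc _ ≤ (4 + 2 * κ) * (A * eform v L (l.foldr (fun i h => if i ∈ S then cellAvg (n + 1) L i h
              else h - cellAvg (n + 1) L i h) g) +
            B * mass L (l.foldr (fun i h => if i ∈ S then cellAvg (n + 1) L i h
              else h - cellAvg (n + 1) L i h) g)) := budget_step_le hL hv hκ hAB S a hF
      _ ≤ (4 + 2 * κ) * ((4 + 2 * κ) ^ l.length * (A * eform v L g + B * mass L g)) := by gcongr
      _ = (4 + 2 * κ) ^ l.length * (4 + 2 * κ) * (A * eform v L g + B * mass L g) := by ring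

/-- **Budget of `Q_S`**: `Φ(Q_S g) ≤ (4 + 2κ)^N Φ(g)`. [folklore] -/
theorem budget_modeProj_le (hL : 0 < L) (hv : Measurable v)
    (hκ : ((n + 1 : ℕ) : ℝ≥0∞) ^ 2 * ((ENNReal.ofReal (L ^ 3))⁻¹ * ∫⁻ x : Space, v ‖x‖) ≤ κ)
    (hAB : A ≤ B) (S : Finset (Fin (n + 1))) {g : Config (n + 1) → ℂ} (hg : ContDiff ℝ 1 g) :
    A * eform v L (modeProj (n + 1) L S g) + B * mass L (modeProj (n + 1) L S g) ≤
      (4 + 2 * κ) ^ (n + 1) * (A * eform v L g + B * mass L g) := by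
  have h := budget_foldr_le hL hv hκ hAB S (List.finRange (n + 1)) hg
  rwa [List.length_finRange] at h

/-! ## The inverse root `n̂₀^{-1/2}` -/

/-- `|(|S|^{-1/2} : ℂ)|² ≤ 1`. [folklore] -/
theorem nnnorm_sq_coef_le_one (S : Finset (Fin (n + 1))) :
    ((‖((Real.sqrt (S.card : ℝ))⁻¹ : ℂ)‖₊ : ℝ≥0∞)) ^ 2 ≤ 1 := by
  rw [coe_nnnorm_sq_eq_ofReal (E := ℂ), Lnss.norm_sq_coef]
  exact ENNReal.ofReal_le_one.2 (Nat.cast_inv_le_one _)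

/-- **Budget of `n̂₀^{-1/2}`**: `Φ(n̂₀^{-1/2} g) ≤ 2^{2^N}·2^N·(4 + 2κ)^N · Φ(g)`. [folklore] -/
theorem budget_rootInv_le (hL : 0 < L) (hv : Measurable v)
    (hκ : ((n + 1 : ℕ) : ℝ≥0∞) ^ 2 * ((ENNReal.ofReal (L ^ 3))⁻¹ * ∫⁻ x : Space, v ‖x‖) ≤ κ)
    (hAB : A ≤ B) {g : Config (n + 1) → ℂ} (hg : ContDiff ℝ 1 g) :
    A * eform v L (rootInv n L g) + B * mass L (rootInv n L g) ≤
      2 ^ (2 ^ (n + 1)) * (2 ^ (n + 1) * ((4 + 2 * κ) ^ (n + 1) * (A * eform v L g + B * mass L g))) := by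
  set 𝒯 := (Finset.univ : Finset (Finset (Fin (n + 1)))).filter
    (fun S : Finset (Fin (n + 1)) => S.Nonempty) with h𝒯
  set Φ := A * eform v L g + B * mass L g with hΦ
  have hQ : ∀ S : Finset (Fin (n + 1)), ContDiff ℝ 1 (modeProj (n + 1) L S g) := fun S =>
    Lnss.contDiff_modeProj S hg
  have hterm : ∀ S ∈ 𝒯, ContDiff ℝ 1 (fun X => ((Real.sqrt (S.card : ℝ))⁻¹ : ℂ) *
      modeProj (n + 1) L S g X) := fun S _ => contDiff_const.mul (hQ S)
  have hcard : 𝒯.card ≤ 2 ^ (n + 1) := by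
    calc 𝒯.card ≤ Fintype.card (Finset (Fin (n + 1))) := Finset.card_le_univ _
      _ = 2 ^ (n + 1) := by rw [Fintype.card_finset, Fintype.card_fin]
  unfold rootInv
  calc A * eform v L (fun X => ∑ S ∈ 𝒯, ((Real.sqrt (S.card : ℝ))⁻¹ : ℂ) * modeProj (n + 1) L S g X) +
        B * mass L (fun X => ∑ S ∈ 𝒯, ((Real.sqrt (S.card : ℝ))⁻¹ : ℂ) * modeProj (n + 1) L S g X)
      ≤ 2 ^ 𝒯.card * ∑ S ∈ 𝒯,
          (A * eform v L (fun X => ((Real.sqrt (S.card : ℝ))⁻¹ : ℂ) * modeProj (n + 1) L S g X) +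
            B * mass L (fun X => ((Real.sqrt (S.card : ℝ))⁻¹ : ℂ) * modeProj (n + 1) L S g X)) :=
        budget_finset_sum_le hv 𝒯 hterm
    _ ≤ 2 ^ 𝒯.card * ∑ S ∈ 𝒯, ((4 + 2 * κ) ^ (n + 1) * Φ) := by
        gcongr with S hS
        exact (budget_smul_le v (nnnorm_sq_coef_le_one S) (hQ S)).trans
          (budget_modeProj_le hL hv hκ hAB S hg)
    _ ≤ 2 ^ (2 ^ (n + 1)) * ∑ _S : Finset (Fin (n + 1)), ((4 + 2 * κ) ^ (n + 1) * Φ) :=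
        mul_le_mul' (pow_le_pow_right₀ one_le_two hcard)
          (Finset.sum_le_sum_of_subset (Finset.subset_univ 𝒯))
    _ = 2 ^ (2 ^ (n + 1)) * (2 ^ (n + 1) * ((4 + 2 * κ) ^ (n + 1) * Φ)) := by
        rw [Finset.sum_const, Finset.card_univ, Fintype.card_finset, Fintype.card_fin, nsmul_eq_mul]
        push_cast
        ring

/-! ## The plane-wave factor -/

/-- **Budget of `e_p(x_a)`**: `Φ(e_p(x_a) f) ≤ (2 + 6N(2π/L)²) Φ(f)` provided `A‖p‖² ≤ B`. [folklore] -/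
theorem budget_phase_le (hL : 0 < L) (hv : Measurable v) (p : Fin 3 → ℤ) (a : Fin (n + 1))
    (hq : A * ENNReal.ofReal (‖(fun j => (p j : ℝ))‖ ^ 2) ≤ B) {f : Config (n + 1) → ℂ}
    (hf : ContDiff ℝ 1 f) :
    A * eform v L (fun Y : Config (n + 1) => cellWave L p (Y a) * f Y) +
        B * mass L (fun Y : Config (n + 1) => cellWave L p (Y a) * f Y) ≤
      (2 + 6 * (((n + 1 : ℕ) : ℝ≥0∞) * ENNReal.ofReal ((2 * Real.pi / L) ^ 2))) *
        (A * eform v L f + B * mass L f) := by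
  set q : ℝ≥0∞ := ENNReal.ofReal (‖(fun j => (p j : ℝ))‖ ^ 2) with hqdef
  set D : ℝ≥0∞ := ENNReal.ofReal ((2 * Real.pi / L) ^ 2) with hD
  have hK : ENNReal.ofReal ((2 * Real.pi * ‖(fun j => (p j : ℝ))‖ / L) ^ 2) = D * q := by
    rw [hD, hqdef, ← ENNReal.ofReal_mul (sq_nonneg _)]
    congr 1
    ring
  have hE := eform_phase_mul_le hL hv p a hf
  rw [hK] at hE
  rw [mass_phase_mul]
  calc A * eform v L (fun Y : Config (n + 1) => cellWave L p (Y a) * f Y) + B * mass L f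
      ≤ A * (2 * eform v L f + 2 * (((n + 1 : ℕ) : ℝ≥0∞) * (3 * (D * q))) * mass L f) +
          B * mass L f := add_le_add (mul_le_mul' le_rfl hE) le_rfl
    _ = 2 * (A * eform v L f) + 6 * (((n + 1 : ℕ) : ℝ≥0∞) * D) * ((A * q) * mass L f) +
          B * mass L f := by ring
    _ ≤ 2 * (A * eform v L f) + 6 * (((n + 1 : ℕ) : ℝ≥0∞) * D) * (B * mass L f) +
          2 * (B * mass L f) :=
        add_le_add (add_le_add le_rfl (mul_le_mul' le_rfl (mul_le_mul' hq le_rfl))) (le_add_self.trans_eq (two_mul _).symm)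
    _ ≤ 2 * (A * eform v L f) + 2 * (B * mass L f) +
          (6 * (((n + 1 : ℕ) : ℝ≥0∞) * D) * (A * eform v L f) +
            6 * (((n + 1 : ℕ) : ℝ≥0∞) * D) * (B * mass L f)) := by
        rw [add_right_comm]
        exact add_le_add le_rfl le_add_self
    _ = _ := by ring

end Bare

/-- **Part 3 of `stub_bareAdmissible` (registered helper statement)**: the budget `A𝓔 + B‖·‖²` (`A ≤ B`) of the
crux's mode projection `Q_S g` is at most `(4 + 2κ)^N` times that of `g`, for any `κ ≥ N²L⁻³‖v‖₁`
(`C¹` `g`, measurable `v`, `L > 0`). [folklore] -/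
theorem bareAdmissible_budget_modeProj_le :
    ∀ (n : ℕ) (L : ℝ) (v : ℝ → ENNReal) (κ A B : ENNReal), 0 < L → Measurable v →
      ((n + 1 : ℕ) : ENNReal) ^ 2 * ((ENNReal.ofReal (L ^ 3))⁻¹ *
        ∫⁻ x : Literature.MathematicalPhysics.QuantumManyBody.BoseGas.Space, v ‖x‖) ≤ κ → A ≤ B →
      ∀ (S : Finset (Fin (n + 1)))
        (g : Literature.MathematicalPhysics.QuantumManyBody.BoseGas.Config (n + 1) → ℂ), ContDiff ℝ 1 g →
          A * eform v L
              (Summit.AtomisticToContinuum.BoseEinsteinCondensation.Theorems.GaussianDominationCan.Negative.modeProj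
                (n + 1) L S g) +
            B * mass L
              (Summit.AtomisticToContinuum.BoseEinsteinCondensation.Theorems.GaussianDominationCan.Negative.modeProj
                (n + 1) L S g) ≤
          (4 + 2 * κ) ^ (n + 1) * (A * eform v L g + B * mass L g) :=
  fun _ _ _ _ _ _ hL hv hκ hAB S _ hg => Bare.budget_modeProj_le hL hv hκ hAB S hg

end Summit.AtomisticToContinuum.BoseEinsteinCondensation.Cruxes.GDTransfer.DysonDressedWitness

end
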